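import Mathlib.Algebra.Order.BigOperators.Group.Finset
import Mathlib.Combinatorics.Enumerative.DoubleCounting
import Mathlib.Data.Nat.Choose.Sum
import Mathlib.Tactic.LinearCombination
import Summits.CriticalPhenomena.PercolationContinuityZ3.Theorems.PercNearOneGluingNoHeavyLowerTailSahiCTCKleitmanSurplus
import HarnessLib

/-!
# `NoHeavyLowerTail` (crux stmt-CriticalPhenomena-4575), P3 lane: the level-`t` DENSITY lemma for the Kleitman surplus (memo g26 §1)

Support file (seat `prim-l12-p3`, gen 26; `--supports stmt-CriticalPhenomena-4575`).  Continues `…SahiCTCKleitmanSurplus`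
(`tr`, `kap`, pair formula, vertex recursion) and generalises `…SahiCTCKleitmanDensity` (the case `t = 2`) to every level `t`.
For up-sets `𝒳, 𝒵`, a sub-cube `(D, s)` whose traces are `t`-live (every member has `≥ t` elements) and `W = csetsT 𝒳 𝒵 D s t`
the common `t`-sets of the traces:
* `cH t n = Σ_{j < min t (n+1-t)} C(n,j)` — the surplus `κ(H_t, H_t)` of the pair "all sets of size `≥ t`" on `n` points;
* `kap_eq_card_inter_of_lt_two_mul` — on fewer than `2t` points a `t`-live pair has no complementary pair inside, `κ = #(common trace)`;
* `card_level_mul_le` (local LYM upwards inside `s`), `choose_mul_card_csetsT_le_level` (iterated), `cH_mul_card_le_card_inter` (base range);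
* `sum_degree_csetsT` (handshake), `cH_pascal`, `cH_mono_step`, `densityT_step_arith` (arithmetic of the step);
* `densityT_le_kap` (**t-DENSITY**): `cH t #s · #W ≤ C(#s,t) · κ(D,s)` — induction on `t`, then on `#s`, peeling a point of minimum
  `t`-degree (vertex recursion: deletion at level `t`, link at level `t−1`); equality at `𝒳 = 𝒵 = {all sets of size ≥ t}`;
* `densityT_le_kap_empty` — the same on the restriction (`D = ∅`) of two `t`-live up-sets.
This is the squarefree part of the ladder inequality `(L_t)` at every level (memo g25 §6, g26 §1).  Nothing is asserted about the crux.
-/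

namespace Summit.CriticalPhenomena.PercolationContinuityZ3.Theorems.SahiCTCForms

open Finset
variable {α : Type*} [DecidableEq α]

/-- The common `t`-sets of the traces on the sub-cube `(D, s)`: `{w ⊆ s : #w = t, D ∪ w ∈ 𝒳, D ∪ w ∈ 𝒵}`. [this work] -/
def csetsT (𝒳 𝒵 : Finset (Finset α)) (D s : Finset α) (t : ℕ) : Finset (Finset α) :=
  (s.powersetCard t).filter fun w => D ∪ w ∈ 𝒳 ∧ D ∪ w ∈ 𝒵

/-- `cH t n = Σ_{j < min t (n+1-t)} C(n,j)`: the Kleitman surplus of the pair (all sets of size `≥ t`, same) on `n` points. [this work] -/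
def cH (t n : ℕ) : ℕ := ∑ j ∈ range (min t (n + 1 - t)), n.choose j

section Basic
variable {𝒳 𝒵 : Finset (Finset α)} {D s : Finset α} {t : ℕ}

/-- Membership in `csetsT`. [this work] -/
theorem mem_csetsT {w : Finset α} : w ∈ csetsT 𝒳 𝒵 D s t ↔ w ⊆ s ∧ #w = t ∧ D ∪ w ∈ 𝒳 ∧ D ∪ w ∈ 𝒵 := by
  unfold csetsT; rw [mem_filter, mem_powersetCard, and_assoc]

/-- Common `t`-sets are common members of the traces. [this work] -/
theorem csetsT_subset_inter : csetsT 𝒳 𝒵 D s t ⊆ tr 𝒳 D s ∩ tr 𝒵 D s := fun w hw => by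
  obtain ⟨hws, _, hX, hZ⟩ := mem_csetsT.1 hw
  exact mem_inter.2 ⟨mem_tr.2 ⟨hws, hX⟩, mem_tr.2 ⟨hws, hZ⟩⟩

/-- `csetsT` is the size-`t` layer of the common trace. [this work] -/
theorem csetsT_eq_filter : csetsT 𝒳 𝒵 D s t = (tr 𝒳 D s ∩ tr 𝒵 D s).filter fun U => #U = t := by
  ext w; simp only [mem_csetsT, mem_filter, mem_inter, mem_tr]; tauto

/-- The common `t`-sets inside `s − v` are those inside `s` avoiding `v`. [this work] -/
theorem csetsT_erase (v : α) : csetsT 𝒳 𝒵 D (s.erase v) t = (csetsT 𝒳 𝒵 D s t).filter fun w => v ∉ w := by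
  ext w; simp only [mem_csetsT, mem_filter, subset_erase]; tauto

/-- The common `t`-sets through `v`, with `v` erased, are common `(t−1)`-sets of the link at `v`. [this work] -/
theorem card_filter_mem_le_card_csetsT_insert (v : α) :
    #((csetsT 𝒳 𝒵 D s t).filter fun w => v ∈ w) ≤ #(csetsT 𝒳 𝒵 (insert v D) (s.erase v) (t - 1)) := by
  refine card_le_card_of_injOn (fun w => w.erase v) (fun w hw => ?_) (fun w hw w' hw' h => ?_)
  · obtain ⟨hwW, hvw⟩ := mem_filter.1 (Finset.mem_coe.1 hw)
    obtain ⟨hws, hwt, hX, hZ⟩ := mem_csetsT.1 hwW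
    have e : insert v D ∪ w.erase v = D ∪ w := by rw [insert_union_eq, insert_erase hvw]
    refine Finset.mem_coe.2 (mem_csetsT.2 ⟨fun x hx => ?_, ?_, e ▸ hX, e ▸ hZ⟩)
    · exact mem_erase.2 ⟨ne_of_mem_erase hx, hws (mem_of_mem_erase hx)⟩
    · show #(w.erase v) = t - 1
      rw [card_erase_of_mem hvw, hwt]
  · have h1 : v ∈ w := (mem_filter.1 (Finset.mem_coe.1 hw)).2
    have h2 : v ∈ w' := (mem_filter.1 (Finset.mem_coe.1 hw')).2
    have h' : w.erase v = w'.erase v := h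
    rw [← insert_erase h1, h', insert_erase h2]

/-- Handshake at level `t`: `Σ_{u ∈ s} deg_W(u) = t·#W`. [folklore] -/
theorem sum_degree_csetsT : ∑ u ∈ s, #((csetsT 𝒳 𝒵 D s t).filter fun w => u ∈ w) = t * #(csetsT 𝒳 𝒵 D s t) := by
  have h := sum_card_bipartiteAbove_eq_sum_card_bipartiteBelow (s := s) (t := csetsT 𝒳 𝒵 D s t) (r := fun u w => u ∈ w)
  simp only [bipartiteAbove, bipartiteBelow] at h
  rw [h]
  have : ∀ w ∈ csetsT 𝒳 𝒵 D s t, #(s.filter fun u => u ∈ w) = t := fun w hw => by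
    obtain ⟨hws, hwt, _⟩ := mem_csetsT.1 hw
    rw [filter_mem_eq_inter, inter_eq_right.2 hws, hwt]
  rw [sum_congr rfl this, sum_const]; simp [mul_comm]

/-- #W = #(W avoiding v) + deg_W(v). [this work] -/
theorem card_csetsT_eq_erase_add (v : α) :
    #(csetsT 𝒳 𝒵 D s t) = #(csetsT 𝒳 𝒵 D (s.erase v) t) + #((csetsT 𝒳 𝒵 D s t).filter fun w => v ∈ w) := by
  rw [csetsT_erase, ← card_filter_add_card_filter_not (s := csetsT 𝒳 𝒵 D s t) (fun w => v ∉ w)]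
  congr 2; ext w; simp only [mem_filter, not_not]

end Basic

/-! ### The base range `#s < 2t`: no complementary pairs, then LYM upwards -/

section BaseRange
variable {𝒳 𝒵 : Finset (Finset α)} {D s : Finset α} {t : ℕ}

/-- A `t`-live pair on fewer than `2t` points has no complementary pair, so `κ = #(common trace)`. [this work] -/
theorem kap_eq_card_inter_of_lt_two_mul (hX : ∀ U ∈ tr 𝒳 D s, t ≤ #U) (hZ : ∀ U ∈ tr 𝒵 D s, t ≤ #U) (hs : #s < 2 * t) :
    kap 𝒳 𝒵 D s = #(tr 𝒳 D s ∩ tr 𝒵 D s) := by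
  unfold kap
  have : ((tr 𝒳 D s).filter fun U => s \ U ∈ tr 𝒵 D s) = ∅ := by
    refine filter_eq_empty_iff.2 fun U hU h => ?_
    have h1 := hX U hU
    have h2 := hZ _ h
    have hUs : U ⊆ s := subset_of_mem_tr hU
    rw [card_sdiff_of_subset hUs] at h2
    have h3 : #U ≤ #s := card_le_card hUs
    omega
  rw [this, card_empty, Nat.cast_zero, sub_zero]

/-- The size-`i` layer of the common trace. [this work] -/
def clevel (𝒳 𝒵 : Finset (Finset α)) (D s : Finset α) (i : ℕ) : Finset (Finset α) :=
  (tr 𝒳 D s ∩ tr 𝒵 D s).filter fun U => #U = i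

/-- Membership in a layer of the common trace. [this work] -/
theorem mem_clevel {i : ℕ} {U : Finset α} : U ∈ clevel 𝒳 𝒵 D s i ↔ (U ∈ tr 𝒳 D s ∧ U ∈ tr 𝒵 D s) ∧ #U = i := by
  unfold clevel; rw [mem_filter, mem_inter]

/-- Local LYM upwards inside `s` for the common trace of two up-sets: `#L_i · (#s − i) ≤ #L_{i+1} · (i+1)`. [folklore] -/
theorem card_level_mul_le (h𝒳 : IsUpperSet (𝒳 : Set (Finset α))) (h𝒵 : IsUpperSet (𝒵 : Set (Finset α))) (i : ℕ) :
    #(clevel 𝒳 𝒵 D s i) * (#s - i) ≤ #(clevel 𝒳 𝒵 D s (i + 1)) * (i + 1) := by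
  refine card_mul_le_card_mul (fun A B => A ⊆ B) (fun A hA => ?_) (fun B hB => ?_)
  · -- every `insert x A`, `x ∈ s \ A`, lies above `A`
    obtain ⟨⟨hAX, hAZ⟩, hAi⟩ := mem_clevel.1 hA
    have hAs : A ⊆ s := subset_of_mem_tr hAX
    have himg : (s \ A).image (fun x => insert x A) ⊆ (clevel 𝒳 𝒵 D s (i + 1)).bipartiteAbove (fun A B => A ⊆ B) A := by
      intro B hB
      obtain ⟨x, hx, rfl⟩ := mem_image.1 hB
      obtain ⟨hxs, hxA⟩ := mem_sdiff.1 hx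
      refine (mem_bipartiteAbove _).2 ⟨mem_clevel.2 ⟨⟨?_, ?_⟩, by rw [card_insert_of_notMem hxA, hAi]⟩, subset_insert x A⟩
      · exact mem_tr_of_subset h𝒳 hAX (subset_insert x A) (insert_subset hxs hAs)
      · exact mem_tr_of_subset h𝒵 hAZ (subset_insert x A) (insert_subset hxs hAs)
    have hinj : Set.InjOn (fun x => insert x A) ↑(s \ A) := fun x hx y hy hxy => by
      have hxA : x ∉ A := (mem_sdiff.1 (Finset.mem_coe.1 hx)).2
      have hxy' : insert x A = insert y A := hxy
      have : x ∈ insert y A := by rw [← hxy']; exact mem_insert_self x A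
      rcases mem_insert.1 this with h | h
      · exact h
      · exact absurd h hxA
    have := card_le_card himg
    rwa [card_image_of_injOn hinj, card_sdiff_of_subset hAs, hAi] at this
  · -- the sets of `L_i` below `B` are among the `i`-subsets of `B`
    obtain ⟨_, hBi⟩ := mem_clevel.1 hB
    have hsub : (clevel 𝒳 𝒵 D s i).bipartiteBelow (fun A B => A ⊆ B) B ⊆ B.powersetCard i := fun A hA => by
      obtain ⟨hAL, hAB⟩ := (mem_bipartiteBelow _).1 hA
      exact mem_powersetCard.2 ⟨hAB, (mem_clevel.1 hAL).2⟩
    have := card_le_card hsub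
    rwa [card_powersetCard, hBi, Nat.choose_succ_self_right] at this

/-- Iterated local LYM: `C(#s,t) · #L_i ≥ C(#s,i) · #W` for `t ≤ i ≤ #s`. [folklore] -/
theorem choose_mul_card_csetsT_le_level (h𝒳 : IsUpperSet (𝒳 : Set (Finset α))) (h𝒵 : IsUpperSet (𝒵 : Set (Finset α))) :
    ∀ i, t ≤ i → i ≤ #s → (#s).choose i * #(csetsT 𝒳 𝒵 D s t) ≤ (#s).choose t * #(clevel 𝒳 𝒵 D s i) := by
  intro i hti
  induction i, hti using Nat.le_induction with
  | base =>
    intro _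
    rw [csetsT_eq_filter]; rfl
  | succ i hti ih =>
    intro his
    have h1 := ih (by omega)
    have h2 := card_level_mul_le (D := D) (s := s) h𝒳 h𝒵 i
    have h3 : (#s).choose (i + 1) * (i + 1) = (#s).choose i * (#s - i) := Nat.choose_succ_right_eq (#s) i
    have h4 : (#s).choose (i + 1) * (i + 1) * #(csetsT 𝒳 𝒵 D s t) ≤ (#s).choose t * #(clevel 𝒳 𝒵 D s (i + 1)) * (i + 1) := by
      calc (#s).choose (i + 1) * (i + 1) * #(csetsT 𝒳 𝒵 D s t)
          = (#s).choose i * #(csetsT 𝒳 𝒵 D s t) * (#s - i) := by rw [h3]; ring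
        _ ≤ (#s).choose t * #(clevel 𝒳 𝒵 D s i) * (#s - i) := Nat.mul_le_mul_right _ h1
        _ = (#s).choose t * (#(clevel 𝒳 𝒵 D s i) * (#s - i)) := by ring
        _ ≤ (#s).choose t * (#(clevel 𝒳 𝒵 D s (i + 1)) * (i + 1)) := Nat.mul_le_mul_left _ h2
        _ = (#s).choose t * #(clevel 𝒳 𝒵 D s (i + 1)) * (i + 1) := by ring
    have h5 : (#s).choose (i + 1) * #(csetsT 𝒳 𝒵 D s t) * (i + 1) ≤ (#s).choose t * #(clevel 𝒳 𝒵 D s (i + 1)) * (i + 1) := by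
      calc (#s).choose (i + 1) * #(csetsT 𝒳 𝒵 D s t) * (i + 1) = (#s).choose (i + 1) * (i + 1) * #(csetsT 𝒳 𝒵 D s t) := by ring
        _ ≤ _ := h4
    exact Nat.le_of_mul_le_mul_right h5 (Nat.succ_pos i)

/-- Base range: for `#s < 2t`, `cH t #s · #W ≤ C(#s,t) · #(common trace)` (the layers `i = t..#s` of the common trace). [this work] -/
theorem cH_mul_card_le_card_inter (h𝒳 : IsUpperSet (𝒳 : Set (Finset α))) (h𝒵 : IsUpperSet (𝒵 : Set (Finset α)))
    (hs : #s < 2 * t) :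
    cH t (#s) * #(csetsT 𝒳 𝒵 D s t) ≤ (#s).choose t * #(tr 𝒳 D s ∩ tr 𝒵 D s) := by
  set n := #s with hn
  have hmin : min t (n + 1 - t) = n + 1 - t := by omega
  unfold cH
  rw [hmin, sum_mul]
  have hdisj : ∀ j ∈ range (n + 1 - t), ∀ j' ∈ range (n + 1 - t), j ≠ j' →
      Disjoint (clevel 𝒳 𝒵 D s (n - j)) (clevel 𝒳 𝒵 D s (n - j')) := fun j hj j' hj' hjj' => by
    refine disjoint_filter.2 fun U _ h1 h2 => hjj' ?_
    have hj1 := mem_range.1 hj; have hj2 := mem_range.1 hj'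
    omega
  have hsub : (range (n + 1 - t)).biUnion (fun j => clevel 𝒳 𝒵 D s (n - j)) ⊆ tr 𝒳 D s ∩ tr 𝒵 D s :=
    biUnion_subset.2 fun j _ => filter_subset _ _
  have hcard := card_le_card hsub
  rw [card_biUnion hdisj] at hcard
  calc ∑ j ∈ range (n + 1 - t), n.choose j * #(csetsT 𝒳 𝒵 D s t)
      ≤ ∑ j ∈ range (n + 1 - t), n.choose t * #(clevel 𝒳 𝒵 D s (n - j)) := by
        refine sum_le_sum fun j hj => ?_
        have hj' := mem_range.1 hj
        have e : n.choose j = n.choose (n - j) := (Nat.choose_symm (by omega)).symm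
        rw [e]
        exact choose_mul_card_csetsT_le_level h𝒳 h𝒵 (n - j) (by omega) (by omega)
    _ = n.choose t * ∑ j ∈ range (n + 1 - t), #(clevel 𝒳 𝒵 D s (n - j)) := by rw [mul_sum]
    _ ≤ n.choose t * #(tr 𝒳 D s ∩ tr 𝒵 D s) := Nat.mul_le_mul_left _ hcard

end BaseRange

/-! ### Arithmetic of `cH` and of the induction step -/

section Arith

/-- Pascal for `cH` in the range `n + 1 ≥ 2t`, `t ≥ 1`: `cH t (n+1) = cH t n + cH (t−1) n`. [this work] -/
theorem cH_pascal (t n : ℕ) (ht : 1 ≤ t) (hn : 2 * t ≤ n + 1) : cH t (n + 1) = cH t n + cH (t - 1) n := by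
  unfold cH
  have e1 : min t (n + 1 + 1 - t) = t := by omega
  have e2 : min t (n + 1 - t) = t := by omega
  have e3 : min (t - 1) (n + 1 - (t - 1)) = t - 1 := by omega
  rw [e1, e2, e3]
  obtain ⟨t', rfl⟩ : ∃ t', t = t' + 1 := ⟨t - 1, by omega⟩
  rw [show t' + 1 - 1 = t' from by omega]
  rw [sum_range_succ' (fun j => (n + 1).choose j), sum_range_succ' (fun j => n.choose j)]
  simp only [Nat.choose_zero_right, Nat.choose_succ_succ', sum_add_distrib]
  ring

/-- The link bound is the smaller one: `(n + 1 − t) · cH (t−1) n ≤ t · cH t n` for `n + 1 ≥ 2t`, `t ≥ 1`. [this work] -/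
theorem cH_mono_step (t n : ℕ) (ht : 1 ≤ t) (hn : 2 * t ≤ n + 1) : (n + 1 - t) * cH (t - 1) n ≤ t * cH t n := by
  unfold cH
  have e2 : min t (n + 1 - t) = t := by omega
  have e3 : min (t - 1) (n + 1 - (t - 1)) = t - 1 := by omega
  rw [e2, e3]
  obtain ⟨t', rfl⟩ : ∃ t', t = t' + 1 := ⟨t - 1, by omega⟩
  rw [show t' + 1 - 1 = t' from by omega]
  have h1 : ∑ j ∈ range t', n.choose (j + 1) ≤ ∑ j ∈ range (t' + 1), n.choose j := by
    rw [sum_range_succ' (fun j => n.choose j)]; omega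
  have h2 : ∀ j ∈ range t', (n + 1 - (t' + 1)) * n.choose j ≤ (t' + 1) * n.choose (j + 1) := fun j hj => by
    have hj := mem_range.1 hj
    have e := Nat.choose_succ_right_eq n j   -- C(n,j+1)*(j+1) = C(n,j)*(n-j)
    have h3 : (n + 1 - (t' + 1)) * n.choose j * (j + 1) ≤ (t' + 1) * n.choose (j + 1) * (j + 1) := by
      calc (n + 1 - (t' + 1)) * n.choose j * (j + 1) = n.choose j * ((n + 1 - (t' + 1)) * (j + 1)) := by ring
        _ ≤ n.choose j * ((n - j) * (t' + 1)) := by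
            refine Nat.mul_le_mul_left _ ?_
            rw [show n + 1 - (t' + 1) = n - t' from by omega]
            zify [(show t' ≤ n from by omega), (show j ≤ n from by omega)]
            nlinarith
        _ = n.choose j * (n - j) * (t' + 1) := by ring
        _ = n.choose (j + 1) * (j + 1) * (t' + 1) := by rw [← e]
        _ = (t' + 1) * n.choose (j + 1) * (j + 1) := by ring
    exact Nat.le_of_mul_le_mul_right h3 (Nat.succ_pos j)
  calc (n + 1 - (t' + 1)) * ∑ j ∈ range t', n.choose j = ∑ j ∈ range t', (n + 1 - (t' + 1)) * n.choose j := by rw [mul_sum]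
    _ ≤ ∑ j ∈ range t', (t' + 1) * n.choose (j + 1) := sum_le_sum h2
    _ = (t' + 1) * ∑ j ∈ range t', n.choose (j + 1) := by rw [← mul_sum]
    _ ≤ (t' + 1) * ∑ j ∈ range (t' + 1), n.choose j := Nat.mul_le_mul_left _ h1

/-- The arithmetic of the induction step (integer form, `n = m + t` points): from the deletion bound `a(W−d) ≤ P κ₀`, the link bound
`b d ≤ Q κ₁`, the handshake `n d ≤ t W`, `m b ≤ t a`, and `m C = n P`, `t C = n Q`, conclude `(a+b) W ≤ C κ`. [this work] -/
theorem densityT_step_arith (n m t a b W d : ℕ) (P Q C κ κ0 κ1 : ℤ) (hn : n = m + t) (ht : 1 ≤ t) (hm : 1 ≤ m)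
    (h0 : (a : ℤ) * ((W : ℤ) - d) ≤ P * κ0) (h1 : (b : ℤ) * d ≤ Q * κ1) (hhand : n * d ≤ t * W)
    (hab : m * b ≤ t * a) (hP : (m : ℤ) * C = n * P) (hQ : (t : ℤ) * C = n * Q) (hk : κ0 + κ1 ≤ κ) (hC : 0 ≤ C) :
    ((a : ℤ) + b) * W ≤ C * κ := by
  have hhand' : (n : ℤ) * d ≤ t * W := by exact_mod_cast hhand
  have hab' : (m : ℤ) * b ≤ t * a := by exact_mod_cast hab
  have s1 : (n : ℤ) * (t * (a * ((W : ℤ) - d)) + m * (b * d)) ≤ (t : ℤ) * m * C * κ := by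
    have e1 : (t : ℤ) * m * C * (κ0 + κ1) = t * (n * P * κ0) + m * (n * Q * κ1) := by
      have e2 : (t : ℤ) * m * C * κ0 = t * (m * C) * κ0 := by ring
      have e3 : (t : ℤ) * m * C * κ1 = m * (t * C) * κ1 := by ring
      rw [mul_add, e2, hP, e3, hQ]; ring
    have hC' : (0 : ℤ) ≤ t * m * C := by positivity
    have i1 : (t : ℤ) * (a * ((W : ℤ) - d)) ≤ t * (P * κ0) := mul_le_mul_of_nonneg_left h0 (by positivity)
    have i2 : (m : ℤ) * (b * d) ≤ m * (Q * κ1) := mul_le_mul_of_nonneg_left h1 (by positivity)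
    calc (n : ℤ) * (t * (a * ((W : ℤ) - d)) + m * (b * d)) ≤ n * (t * (P * κ0) + m * (Q * κ1)) :=
          mul_le_mul_of_nonneg_left (by linarith) (by positivity)
      _ = t * (n * P * κ0) + m * (n * Q * κ1) := by ring
      _ = t * m * C * (κ0 + κ1) := e1.symm
      _ ≤ t * m * C * κ := mul_le_mul_of_nonneg_left hk hC'
  have s2 : (t : ℤ) * m * W * (a + b) ≤ (n : ℤ) * (t * (a * ((W : ℤ) - d)) + m * (b * d)) := by
    have hpos : (0 : ℤ) ≤ t * a - m * b := by linarith
    have i3 : (n : ℤ) * d * (t * a - m * b) ≤ t * W * (t * a - m * b) := mul_le_mul_of_nonneg_right hhand' hpos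
    have e2 : (n : ℤ) * (t * (a * ((W : ℤ) - d)) + m * (b * d)) = n * t * a * W - n * d * (t * a - m * b) := by ring
    have e3 : (t : ℤ) * m * W * (a + b) = n * t * a * W - t * W * (t * a - m * b) := by rw [hn]; push_cast; ring
    rw [e2, e3]; linarith
  have s3 : (t : ℤ) * m * ((a + b) * W) ≤ (t : ℤ) * m * (C * κ) := by
    calc (t : ℤ) * m * ((a + b) * W) = t * m * W * (a + b) := by ring
      _ ≤ _ := s2
      _ ≤ t * m * C * κ := s1
      _ = t * m * (C * κ) := by ring
  have htm : (0 : ℤ) < t * m := by positivity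
  exact le_of_mul_le_mul_left s3 htm

end Arith

/-! ### The level-`t` density lemma -/

section DensityT
variable {𝒳 𝒵 : Finset (Finset α)}

/-- **t-DENSITY** (all levels): for up-sets `𝒳, 𝒵` and a sub-cube `(D, s)` with `t`-live traces,
`cH t #s · #(csetsT 𝒳 𝒵 D s t) ≤ C(#s, t) · κ(D, s)`.  Induction on `t`, then on `#s`: below `2t` points the pair formula has no
negative pairs and iterated local LYM counts the common trace; from `2t` points on, peel a point `v` of minimum `t`-degree with the vertex
recursion (deletion: level `t` on `#s − 1` points; link: level `t − 1`), the handshake and `cH t n = cH t (n−1) + cH (t−1) (n−1)`. [this work] -/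
theorem densityT_le_kap (h𝒳 : IsUpperSet (𝒳 : Set (Finset α))) (h𝒵 : IsUpperSet (𝒵 : Set (Finset α))) :
    ∀ (t n : ℕ) (D s : Finset α), Disjoint D s → #s = n → (∀ U ∈ tr 𝒳 D s, t ≤ #U) → (∀ U ∈ tr 𝒵 D s, t ≤ #U) →
      (cH t n : ℤ) * #(csetsT 𝒳 𝒵 D s t) ≤ (n.choose t : ℤ) * kap 𝒳 𝒵 D s := by
  intro t
  induction t with
  | zero =>
    intro n D s hDs _ _ _
    have h0 : cH 0 n = 0 := by unfold cH; simp
    rw [h0, Nat.cast_zero, zero_mul, Nat.choose_zero_right, Nat.cast_one, one_mul]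
    exact kap_nonneg h𝒳 h𝒵 s D hDs
  | succ t iht =>
    intro n
    induction n using Nat.strong_induction_on with
    | _ n ih =>
    intro D s hDs hsn hX hZ
    have hk : 0 ≤ kap 𝒳 𝒵 D s := kap_nonneg h𝒳 h𝒵 s D hDs
    by_cases hlt : n < 2 * (t + 1)
    · -- base range
      rw [← hsn, kap_eq_card_inter_of_lt_two_mul hX hZ (hsn ▸ hlt)]
      exact_mod_cast cH_mul_card_le_card_inter (D := D) h𝒳 h𝒵 (hsn ▸ hlt)
    · -- step: peel a point of minimum degree
      have hn2 : 2 * (t + 1) ≤ n := by omega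
      have hsne : s.Nonempty := card_pos.1 (by omega)
      set W := csetsT 𝒳 𝒵 D s (t + 1) with hW
      obtain ⟨v, hv, hmin⟩ := exists_min_image s (fun u => #(W.filter fun w => u ∈ w)) hsne
      have hvD : v ∉ D := fun h => (disjoint_left.1 hDs h) hv
      set d := #(W.filter fun w => v ∈ w) with hd
      have hhand : n * d ≤ (t + 1) * #W := by
        have h1 := card_nsmul_le_sum s (fun u => #(W.filter fun w => u ∈ w)) _ fun u hu => hmin u hu
        rw [sum_degree_csetsT, hsn] at h1; simpa using h1
      have hrec := kap_rec (𝒳 := 𝒳) (𝒵 := 𝒵) (D := D) h𝒳 h𝒵 hv hvD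
      have hs' : #(s.erase v) = n - 1 := by rw [card_erase_of_mem hv, hsn]
      have hDs' : Disjoint D (s.erase v) := Disjoint.mono_right (erase_subset v s) hDs
      have hDs'' : Disjoint (insert v D) (s.erase v) := by
        rw [disjoint_insert_left]; exact ⟨notMem_erase v s, hDs'⟩
      have hX0 : ∀ U ∈ tr 𝒳 D (s.erase v), t + 1 ≤ #U := fun U hU => hX U (mem_tr_erase_iff.1 hU).2
      have hZ0 : ∀ U ∈ tr 𝒵 D (s.erase v), t + 1 ≤ #U := fun U hU => hZ U (mem_tr_erase_iff.1 hU).2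
      have hX1 : ∀ R ∈ tr 𝒳 (insert v D) (s.erase v), t ≤ #R := fun R hR => by
        obtain ⟨hvR, hR'⟩ := (mem_tr_insert_iff hv).1 hR
        have := hX _ hR'
        rw [card_insert_of_notMem hvR] at this; omega
      have hZ1 : ∀ R ∈ tr 𝒵 (insert v D) (s.erase v), t ≤ #R := fun R hR => by
        obtain ⟨hvR, hR'⟩ := (mem_tr_insert_iff hv).1 hR
        have := hZ _ hR'
        rw [card_insert_of_notMem hvR] at this; omega
      have hIH0 := ih (n - 1) (by omega) D (s.erase v) hDs' hs' hX0 hZ0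
      have hIH1 := iht (n - 1) (insert v D) (s.erase v) hDs'' hs' hX1 hZ1
      have hcardW : #W = #(csetsT 𝒳 𝒵 D (s.erase v) (t + 1)) + d := card_csetsT_eq_erase_add v
      have hW1 : d ≤ #(csetsT 𝒳 𝒵 (insert v D) (s.erase v) t) := by
        have := card_filter_mem_le_card_csetsT_insert (𝒳 := 𝒳) (𝒵 := 𝒵) (D := D) (s := s) (t := t + 1) v
        simpa using this

      have hχ : (0 : ℤ) ≤ #((tr 𝒳 (insert v D) (s.erase v) \ tr 𝒳 D (s.erase v)).filter fun R =>
          s.erase v \ R ∈ tr 𝒵 (insert v D) (s.erase v) ∧ s.erase v \ R ∉ tr 𝒵 D (s.erase v)) := Nat.cast_nonneg _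
      have hksum : kap 𝒳 𝒵 D (s.erase v) + kap 𝒳 𝒵 (insert v D) (s.erase v) ≤ kap 𝒳 𝒵 D s := by rw [hrec]; linarith
      obtain ⟨m, hm⟩ : ∃ m, n = m + 1 := ⟨n - 1, by omega⟩
      have hm1 : n - 1 = m := by omega
      rw [hm1] at hIH0 hIH1
      obtain ⟨m', hm'⟩ : ∃ m', m = m' + t := ⟨m - t, by omega⟩
      have hpas : cH (t + 1) n = cH (t + 1) m + cH t m := by
        rw [hm]; have := cH_pascal (t + 1) m (by omega) (by omega); simpa using this
      have hmono : m' * cH t m ≤ (t + 1) * cH (t + 1) m := by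
        have := cH_mono_step (t + 1) m (by omega) (by omega)
        have e : m + 1 - (t + 1) = m' := by omega
        rw [e] at this; simpa using this
      have e1 := Nat.add_one_mul_choose_eq m t          -- (m+1) * C(m,t) = C(m+1,t+1) * (t+1)
      have e3 := Nat.choose_succ_succ' m t              -- C(m+1,t+1) = C(m,t) + C(m,t+1)
      have hPC : (m' : ℤ) * ((n.choose (t + 1) : ℕ) : ℤ) = (n : ℤ) * ((m.choose (t + 1) : ℕ) : ℤ) := by
        rw [hm]
        have e1' : (((m + 1) * m.choose t : ℕ) : ℤ) = (((m + 1).choose (t + 1) * (t + 1) : ℕ) : ℤ) := by rw [e1]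
        have e3' : (((m + 1).choose (t + 1) : ℕ) : ℤ) = ((m.choose t + m.choose (t + 1) : ℕ) : ℤ) := by rw [e3]
        push_cast at e1' e3' ⊢
        have hmz : (m : ℤ) = m' + t := by exact_mod_cast hm'
        rw [hmz] at e1' ⊢
        linear_combination e1' + ((m' : ℤ) + t + 1) * e3'
      have hQC : ((t + 1 : ℕ) : ℤ) * ((n.choose (t + 1) : ℕ) : ℤ) = (n : ℤ) * ((m.choose t : ℕ) : ℤ) := by
        rw [hm]
        have e1' : (((m + 1) * m.choose t : ℕ) : ℤ) = (((m + 1).choose (t + 1) * (t + 1) : ℕ) : ℤ) := by rw [e1]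
        push_cast at e1' ⊢
        linear_combination -e1'
      rw [hpas]; push_cast
      have hIH0' : (cH (t + 1) m : ℤ) * ((#W : ℤ) - d) ≤ (m.choose (t + 1) : ℤ) * kap 𝒳 𝒵 D (s.erase v) := by
        have e : ((#W : ℤ) - d) = #(csetsT 𝒳 𝒵 D (s.erase v) (t + 1)) := by rw [hcardW]; push_cast; ring
        rw [e]; exact hIH0
      have hIH1' : (cH t m : ℤ) * d ≤ (m.choose t : ℤ) * kap 𝒳 𝒵 (insert v D) (s.erase v) := by
        calc (cH t m : ℤ) * d ≤ (cH t m : ℤ) * #(csetsT 𝒳 𝒵 (insert v D) (s.erase v) t) :=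
              mul_le_mul_of_nonneg_left (by exact_mod_cast hW1) (Nat.cast_nonneg _)
          _ ≤ _ := hIH1
      have hfin := densityT_step_arith n m' (t + 1) (cH (t + 1) m) (cH t m) #W d (m.choose (t + 1)) (m.choose t)
        (n.choose (t + 1)) (kap 𝒳 𝒵 D s) (kap 𝒳 𝒵 D (s.erase v)) (kap 𝒳 𝒵 (insert v D) (s.erase v))
        (by omega) (by omega) (by omega) hIH0' hIH1' hhand hmono (by exact_mod_cast hPC) (by exact_mod_cast hQC) hksum
        (by positivity)
      exact hfin

/-- **t-DENSITY** for the restriction of two `t`-live up-sets to a finset `s`: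
`cH t #s · #(common t-sets inside s) ≤ C(#s,t) · κ(∅, s)`. [this work] -/
theorem densityT_le_kap_empty (h𝒳 : IsUpperSet (𝒳 : Set (Finset α))) (h𝒵 : IsUpperSet (𝒵 : Set (Finset α)))
    {t : ℕ} (hXt : ∀ U ∈ 𝒳, t ≤ #U) (hZt : ∀ U ∈ 𝒵, t ≤ #U) (s : Finset α) :
    (cH t #s : ℤ) * #(csetsT 𝒳 𝒵 ∅ s t) ≤ ((#s).choose t : ℤ) * kap 𝒳 𝒵 ∅ s :=
  densityT_le_kap h𝒳 h𝒵 t #s ∅ s (disjoint_empty_left s) rfl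
    (fun U hU => hXt U (mem_tr_empty.1 hU).2) (fun U hU => hZt U (mem_tr_empty.1 hU).2)

end DensityT

end Summit.CriticalPhenomena.PercolationContinuityZ3.Theorems.SahiCTCForms
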